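import Literature.Analysis.FluidPDE.PassiveScalarDiagForcedClass
import HarnessLib

/-!
# Linearity of the class of weak diagonal-diffusion passive scalars with a source

Analysis/FluidPDE proof-support file (everything proved). The weak formulation of
`∂ₜθ + u·∇θ = κ ∑ᵢ aᵢ ∂ᵢ∂ᵢθ + s` on `T^d × [0,T)` (`Torus.IsWeakScalarTransportDiagForcedOn T a κ u s θ₀ θ`,
DiPerna–Lions 1989, §II.1 (12)–(14) with a right-hand side) is linear in the triple
`(θ, s, θ₀)` for a FIXED drift `u`:

* `IsWeakScalarTransportDiagForcedOn.smul` — constant multiples `(c θ, c s, c θ₀)`;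
* `….sub`, `….add` — differences and sums, for integrable data (the datum enters through
  `∫ θ₀ ψ(0)`, which must split);
* `….sub_of_eq_datum` — the difference of two solutions with the SAME datum solves the problem
  with the difference of the sources from datum `0` (no integrability needed); the case of equal
  sources (homogeneous problem, the input of uniqueness) is `….sub_of_eq` of
  `PassiveScalarDiagUniqueness`;
* `….sub_homogeneous` — the Duhamel splitting `θ = θʰ + θᶠ`: `θ - θʰ` solves the sourced
  problem from datum `0` when `θʰ` solves the homogeneous one from the same datum (cell
  `ad-ideate`, ROUND-10 §B3 Step 1).

Isotropic twins: `IsWeakScalarTransportOn.sub_of_eq_datum` (`PassiveScalarUniquenessL1Sobolev`),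
`isWeakScalarTransportOn_sub` (Summits side); diagonal, equal sources: `….sub_of_eq`
(`PassiveScalarDiagUniqueness`).

## References

* R. J. DiPerna, P.-L. Lions, Invent. Math. 98 (1989), §II.1, (12)–(14). [`DiPernaLions1989`]
-/

noncomputable section

open _root_.MeasureTheory _root_.Set _root_.Filter _root_.Function _root_.TopologicalSpace
open scoped ENNReal NNReal InnerProductSpace ContDiff

namespace Literature.Analysis.FluidPDE

namespace Torus

variable {d : Type*} [Fintype d] [DecidableEq d]

omit [Fintype d] [DecidableEq d] in
/-- `(a + b)² ≤ 2a² + 2b²` in `ℝ≥0∞`. [folklore] -/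
private theorem ennreal_add_sq_le_aux (a b : ℝ≥0∞) : (a + b) ^ 2 ≤ 2 * a ^ 2 + 2 * b ^ 2 := by
  rcases eq_or_ne a ⊤ with rfl | ha
  · simp
  rcases eq_or_ne b ⊤ with rfl | hb
  · simp
  lift a to ℝ≥0 using ha
  lift b to ℝ≥0 using hb
  have h : ((a + b) ^ 2 : ℝ≥0) ≤ 2 * a ^ 2 + 2 * b ^ 2 := by
    rw [← NNReal.coe_le_coe]
    push_cast
    nlinarith [sq_nonneg ((a : ℝ) - b)]
  exact_mod_cast h

namespace IsWeakScalarTransportDiagForcedOn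

variable {T κ : ℝ} {a : d → ℝ} {u : ℝ → UnitAddTorus d → EuclideanSpace ℝ d}
  {s s₁ s₂ : ℝ → UnitAddTorus d → ℝ} {θ₀ θ₀₁ θ₀₂ : UnitAddTorus d → ℝ} {θ θ₁ θ₂ : ℝ → UnitAddTorus d → ℝ}

/-! ## Constant multiples -/

/-- **Constant multiples**: `(c θ, c s, c θ₀)` is a weak solution if `(θ, s, θ₀)` is (every clause
is homogeneous; the weak identity is multiplied by `c`). [cite: DiPernaLions1989, §II.1 (12)–(14)] -/
theorem smul (h : IsWeakScalarTransportDiagForcedOn T a κ u s θ₀ θ) (c : ℝ) :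
    IsWeakScalarTransportDiagForcedOn T a κ u (fun t x => c * s t x) (fun x => c * θ₀ x)
      (fun t x => c * θ t x) := by
  obtain ⟨C, hC⟩ := h.ae_lintegral_sq_le
  refine ⟨?_, h.aestronglyMeasurable_velocity, ?_, ⟨‖c‖₊ ^ 2 * C, ?_⟩, h.lintegral_velocity_lt_top,
    ?_, ?_, h.ae_isWeaklyDivFree, fun ψ hψ => ?_⟩
  · exact (aestronglyMeasurable_const (b := c)).mul h.aestronglyMeasurable
  · exact (aestronglyMeasurable_const (b := c)).mul h.aestronglyMeasurable_source
  · filter_upwards [hC] with t ht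
    have e : ∫⁻ x, ‖c * θ t x‖ₑ ^ 2 = ‖c‖ₑ ^ 2 * ∫⁻ x, ‖θ t x‖ₑ ^ 2 := by
      rw [← lintegral_const_mul' _ _ (by simp)]
      exact lintegral_congr fun x => by rw [enorm_mul, mul_pow]
    calc ∫⁻ x, ‖c * θ t x‖ₑ ^ 2 = ‖c‖ₑ ^ 2 * ∫⁻ x, ‖θ t x‖ₑ ^ 2 := e
      _ ≤ ‖c‖ₑ ^ 2 * C := by gcongr
      _ = ((‖c‖₊ ^ 2 * C : ℝ≥0) : ℝ≥0∞) := by rw [ENNReal.coe_mul, ENNReal.coe_pow, enorm_eq_nnnorm]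
  · have e : ∫⁻ t in Ioo 0 T, ∫⁻ x, ‖u t x‖ₑ * ‖c * θ t x‖ₑ =
        ‖c‖ₑ * ∫⁻ t in Ioo 0 T, ∫⁻ x, ‖u t x‖ₑ * ‖θ t x‖ₑ := by
      rw [← lintegral_const_mul' _ _ (by simp)]
      refine lintegral_congr fun t => ?_
      rw [← lintegral_const_mul' _ _ (by simp)]
      exact lintegral_congr fun x => by rw [enorm_mul]; ring
    rw [e]
    exact ENNReal.mul_lt_top (by simp) h.lintegral_mul_lt_top
  · have e : ∫⁻ t in Ioo 0 T, ∫⁻ x, ‖c * s t x‖ₑ = ‖c‖ₑ * ∫⁻ t in Ioo 0 T, ∫⁻ x, ‖s t x‖ₑ := by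
      rw [← lintegral_const_mul' _ _ (by simp)]
      refine lintegral_congr fun t => ?_
      rw [← lintegral_const_mul' _ _ (by simp)]
      exact lintegral_congr fun x => by rw [enorm_mul]
    rw [e]
    exact ENNReal.mul_lt_top (by simp) h.lintegral_source_lt_top
  · have key := h.weak_eq ψ hψ
    have e1 : ∀ t, (∫ x, c * θ t x * (FunctionSpaces.Torus.timeDeriv ψ t x +
          ⟪u t x, FunctionSpaces.Torus.gradient (ψ t) x⟫_ℝ +
          κ * ∑ i, a i * FunctionSpaces.Torus.partialDeriv i
            (FunctionSpaces.Torus.partialDeriv i (ψ t)) x)) =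
        c * ∫ x, θ t x * (FunctionSpaces.Torus.timeDeriv ψ t x +
          ⟪u t x, FunctionSpaces.Torus.gradient (ψ t) x⟫_ℝ +
          κ * ∑ i, a i * FunctionSpaces.Torus.partialDeriv i
            (FunctionSpaces.Torus.partialDeriv i (ψ t)) x) := by
      intro t
      rw [← integral_const_mul]
      exact integral_congr_ae (Eventually.of_forall fun x => by ring)
    have e2 : ∀ t, (∫ x, c * s t x * ψ t x) = c * ∫ x, s t x * ψ t x := by
      intro t
      rw [← integral_const_mul]
      exact integral_congr_ae (Eventually.of_forall fun x => by ring)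
    have e3 : (∫ x, c * θ₀ x * ψ 0 x) = c * ∫ x, θ₀ x * ψ 0 x := by
      rw [← integral_const_mul]
      exact integral_congr_ae (Eventually.of_forall fun x => by ring)
    simp_rw [e1, e2]
    rw [integral_const_mul, integral_const_mul, e3, ← mul_add, ← mul_add, key, mul_zero]

/-! ## Differences and sums -/

/-- The `L^∞_t L²_x` clause for a difference. [folklore] -/
private theorem ae_lintegral_sq_sub_le_aux (h₁ : IsWeakScalarTransportDiagForcedOn T a κ u s₁ θ₀₁ θ₁)
    (h₂ : IsWeakScalarTransportDiagForcedOn T a κ u s₂ θ₀₂ θ₂) :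
    ∃ C : ℝ≥0, ∀ᵐ t ∂(volume.restrict (Ioo 0 T)), ∫⁻ x, ‖θ₁ t x - θ₂ t x‖ₑ ^ 2 ≤ C := by
  obtain ⟨C₁, hC₁⟩ := h₁.ae_lintegral_sq_le
  obtain ⟨C₂, hC₂⟩ := h₂.ae_lintegral_sq_le
  refine ⟨2 * C₁ + 2 * C₂, ?_⟩
  filter_upwards [hC₁, hC₂, h₁.ae_aestronglyMeasurable_slice] with t ht₁ ht₂ hm₁
  calc ∫⁻ x, ‖θ₁ t x - θ₂ t x‖ₑ ^ 2 ≤ ∫⁻ x, (2 * ‖θ₁ t x‖ₑ ^ 2 + 2 * ‖θ₂ t x‖ₑ ^ 2) := by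
        refine lintegral_mono fun x => (le_trans ?_ (ennreal_add_sq_le_aux _ _))
        gcongr
        exact enorm_sub_le
    _ = (∫⁻ x, 2 * ‖θ₁ t x‖ₑ ^ 2) + ∫⁻ x, 2 * ‖θ₂ t x‖ₑ ^ 2 :=
        lintegral_add_left' ((hm₁.enorm.pow_const 2).const_mul _) _
    _ ≤ 2 * C₁ + 2 * C₂ := by
        rw [lintegral_const_mul' _ _ ENNReal.ofNat_ne_top, lintegral_const_mul' _ _ ENNReal.ofNat_ne_top]
        gcongr

/-- The `u θ ∈ L¹` clause for a difference (on the product, where the two pieces add up). [folklore] -/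
private theorem lintegral_mul_sub_lt_top_aux (h₁ : IsWeakScalarTransportDiagForcedOn T a κ u s₁ θ₀₁ θ₁)
    (h₂ : IsWeakScalarTransportDiagForcedOn T a κ u s₂ θ₀₂ θ₂) :
    ∫⁻ t in Ioo 0 T, ∫⁻ x, ‖u t x‖ₑ * ‖θ₁ t x - θ₂ t x‖ₑ < ⊤ := by
  set μ : Measure (ℝ × UnitAddTorus d) := ((volume : Measure ℝ).restrict (Ioo 0 T)).prod volume with hμ
  have hmu := h₁.aestronglyMeasurable_uncurry_velocity
  have hF₁ : AEMeasurable (fun p : ℝ × UnitAddTorus d => ‖u p.1 p.2‖ₑ * ‖θ₁ p.1 p.2‖ₑ) μ :=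
    hmu.enorm.mul h₁.aestronglyMeasurable_uncurry.enorm
  have hF₂ : AEMeasurable (fun p : ℝ × UnitAddTorus d => ‖u p.1 p.2‖ₑ * ‖θ₂ p.1 p.2‖ₑ) μ :=
    hmu.enorm.mul h₂.aestronglyMeasurable_uncurry.enorm
  have hF : AEMeasurable (fun p : ℝ × UnitAddTorus d => ‖u p.1 p.2‖ₑ * ‖θ₁ p.1 p.2 - θ₂ p.1 p.2‖ₑ) μ :=
    hmu.enorm.mul (h₁.aestronglyMeasurable_uncurry.sub h₂.aestronglyMeasurable_uncurry).enorm
  have e : ∀ {F : ℝ × UnitAddTorus d → ℝ≥0∞}, AEMeasurable F μ →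
      ∫⁻ t in Ioo 0 T, ∫⁻ x, F (t, x) = ∫⁻ p, F p ∂μ := fun hF => (lintegral_prod _ hF).symm
  rw [e hF]
  have h1 : ∫⁻ p, ‖u p.1 p.2‖ₑ * ‖θ₁ p.1 p.2‖ₑ ∂μ < ⊤ := by rw [← e hF₁]; exact h₁.lintegral_mul_lt_top
  have h2 : ∫⁻ p, ‖u p.1 p.2‖ₑ * ‖θ₂ p.1 p.2‖ₑ ∂μ < ⊤ := by rw [← e hF₂]; exact h₂.lintegral_mul_lt_top
  calc ∫⁻ p, ‖u p.1 p.2‖ₑ * ‖θ₁ p.1 p.2 - θ₂ p.1 p.2‖ₑ ∂μ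
      ≤ ∫⁻ p, (‖u p.1 p.2‖ₑ * ‖θ₁ p.1 p.2‖ₑ + ‖u p.1 p.2‖ₑ * ‖θ₂ p.1 p.2‖ₑ) ∂μ := by
        refine lintegral_mono fun p => ?_
        rw [← mul_add]
        gcongr
        exact enorm_sub_le
    _ = (∫⁻ p, ‖u p.1 p.2‖ₑ * ‖θ₁ p.1 p.2‖ₑ ∂μ) + ∫⁻ p, ‖u p.1 p.2‖ₑ * ‖θ₂ p.1 p.2‖ₑ ∂μ :=
        lintegral_add_left' hF₁ _
    _ < ⊤ := ENNReal.add_lt_top.2 ⟨h1, h2⟩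

/-- The `s ∈ L¹` clause for a difference of sources. [folklore] -/
private theorem lintegral_source_sub_lt_top_aux (h₁ : IsWeakScalarTransportDiagForcedOn T a κ u s₁ θ₀₁ θ₁)
    (h₂ : IsWeakScalarTransportDiagForcedOn T a κ u s₂ θ₀₂ θ₂) :
    ∫⁻ t in Ioo 0 T, ∫⁻ x, ‖s₁ t x - s₂ t x‖ₑ < ⊤ := by
  set μ : Measure (ℝ × UnitAddTorus d) := ((volume : Measure ℝ).restrict (Ioo 0 T)).prod volume with hμ
  have hF₁ : AEMeasurable (fun p : ℝ × UnitAddTorus d => ‖s₁ p.1 p.2‖ₑ) μ :=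
    h₁.aestronglyMeasurable_uncurry_source.enorm
  have hF₂ : AEMeasurable (fun p : ℝ × UnitAddTorus d => ‖s₂ p.1 p.2‖ₑ) μ :=
    h₂.aestronglyMeasurable_uncurry_source.enorm
  have hF : AEMeasurable (fun p : ℝ × UnitAddTorus d => ‖s₁ p.1 p.2 - s₂ p.1 p.2‖ₑ) μ :=
    (h₁.aestronglyMeasurable_uncurry_source.sub h₂.aestronglyMeasurable_uncurry_source).enorm
  have e : ∀ {F : ℝ × UnitAddTorus d → ℝ≥0∞}, AEMeasurable F μ →
      ∫⁻ t in Ioo 0 T, ∫⁻ x, F (t, x) = ∫⁻ p, F p ∂μ := fun hF => (lintegral_prod _ hF).symm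
  rw [e hF]
  have h1 : ∫⁻ p, ‖s₁ p.1 p.2‖ₑ ∂μ < ⊤ := by rw [← e hF₁]; exact h₁.lintegral_source_lt_top
  have h2 : ∫⁻ p, ‖s₂ p.1 p.2‖ₑ ∂μ < ⊤ := by rw [← e hF₂]; exact h₂.lintegral_source_lt_top
  calc ∫⁻ p, ‖s₁ p.1 p.2 - s₂ p.1 p.2‖ₑ ∂μ ≤ ∫⁻ p, (‖s₁ p.1 p.2‖ₑ + ‖s₂ p.1 p.2‖ₑ) ∂μ :=
        lintegral_mono fun p => enorm_sub_le
    _ = (∫⁻ p, ‖s₁ p.1 p.2‖ₑ ∂μ) + ∫⁻ p, ‖s₂ p.1 p.2‖ₑ ∂μ := lintegral_add_left' hF₁ _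
    _ < ⊤ := ENNReal.add_lt_top.2 ⟨h1, h2⟩

/-- The weak identity for a difference, with the datum terms kept separate. [folklore] -/
private theorem weak_sub_aux (h₁ : IsWeakScalarTransportDiagForcedOn T a κ u s₁ θ₀₁ θ₁)
    (h₂ : IsWeakScalarTransportDiagForcedOn T a κ u s₂ θ₀₂ θ₂) {ψ : ℝ → UnitAddTorus d → ℝ}
    (hψ : FunctionSpaces.Torus.IsSpaceTimeTest T ψ) :
    (∫ t in Ioo 0 T, ∫ x, (θ₁ t x - θ₂ t x) * (FunctionSpaces.Torus.timeDeriv ψ t x +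
        ⟪u t x, FunctionSpaces.Torus.gradient (ψ t) x⟫_ℝ +
        κ * ∑ i, a i * FunctionSpaces.Torus.partialDeriv i
          (FunctionSpaces.Torus.partialDeriv i (ψ t)) x)) +
      (∫ t in Ioo 0 T, ∫ x, (s₁ t x - s₂ t x) * ψ t x) +
      ((∫ x, θ₀₁ x * ψ 0 x) - ∫ x, θ₀₂ x * ψ 0 x) = 0 := by
  have e₁ := h₁.weak_eq ψ hψ
  have e₂ := h₂.weak_eq ψ hψ
  have hI₁ := h₁.integrable_weakIntegrand hψ
  have hI₂ := h₂.integrable_weakIntegrand hψ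
  have hS₁ := h₁.integrable_source_mul_test hψ
  have hS₂ := h₂.integrable_source_mul_test hψ
  have hslice : ∀ᵐ t ∂(volume.restrict (Ioo 0 T)),
      (∫ x, (θ₁ t x - θ₂ t x) * (FunctionSpaces.Torus.timeDeriv ψ t x +
        ⟪u t x, FunctionSpaces.Torus.gradient (ψ t) x⟫_ℝ +
        κ * ∑ i, a i * FunctionSpaces.Torus.partialDeriv i
          (FunctionSpaces.Torus.partialDeriv i (ψ t)) x)) =
      (∫ x, θ₁ t x * (FunctionSpaces.Torus.timeDeriv ψ t x +
        ⟪u t x, FunctionSpaces.Torus.gradient (ψ t) x⟫_ℝ +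
        κ * ∑ i, a i * FunctionSpaces.Torus.partialDeriv i
          (FunctionSpaces.Torus.partialDeriv i (ψ t)) x)) -
      ∫ x, θ₂ t x * (FunctionSpaces.Torus.timeDeriv ψ t x +
        ⟪u t x, FunctionSpaces.Torus.gradient (ψ t) x⟫_ℝ +
        κ * ∑ i, a i * FunctionSpaces.Torus.partialDeriv i
          (FunctionSpaces.Torus.partialDeriv i (ψ t)) x) := by
    filter_upwards [hI₁.prod_right_ae, hI₂.prod_right_ae] with t ht₁ ht₂
    rw [← integral_sub ht₁ ht₂]
    refine integral_congr_ae (Eventually.of_forall fun x => ?_)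
    dsimp only
    ring
  have hslice' : ∀ᵐ t ∂(volume.restrict (Ioo 0 T)),
      (∫ x, (s₁ t x - s₂ t x) * ψ t x) = (∫ x, s₁ t x * ψ t x) - ∫ x, s₂ t x * ψ t x := by
    filter_upwards [hS₁.prod_right_ae, hS₂.prod_right_ae] with t ht₁ ht₂
    rw [← integral_sub ht₁ ht₂]
    refine integral_congr_ae (Eventually.of_forall fun x => ?_)
    dsimp only
    ring
  rw [integral_congr_ae hslice, integral_congr_ae hslice',
    integral_sub hI₁.integral_prod_left hI₂.integral_prod_left,
    integral_sub hS₁.integral_prod_left hS₂.integral_prod_left]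
  linarith

/-- **Differences with the same datum**: the difference of two weak solutions with the same drift
and datum is a weak solution with the difference of the sources from datum `0` (no integrability
of the datum needed). [cite: DiPernaLions1989, §II.1 (12)–(14)] -/
theorem sub_of_eq_datum (h₁ : IsWeakScalarTransportDiagForcedOn T a κ u s₁ θ₀ θ₁)
    (h₂ : IsWeakScalarTransportDiagForcedOn T a κ u s₂ θ₀ θ₂) :
    IsWeakScalarTransportDiagForcedOn T a κ u (fun t x => s₁ t x - s₂ t x) 0
      (fun t x => θ₁ t x - θ₂ t x) := by
  refine ⟨h₁.aestronglyMeasurable.sub h₂.aestronglyMeasurable, h₁.aestronglyMeasurable_velocity,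
    h₁.aestronglyMeasurable_source.sub h₂.aestronglyMeasurable_source, ae_lintegral_sq_sub_le_aux h₁ h₂,
    h₁.lintegral_velocity_lt_top, lintegral_mul_sub_lt_top_aux h₁ h₂, lintegral_source_sub_lt_top_aux h₁ h₂,
    h₁.ae_isWeaklyDivFree, fun ψ hψ => ?_⟩
  have key := weak_sub_aux h₁ h₂ hψ
  simp only [sub_self, add_zero] at key
  simpa only [Pi.zero_apply, zero_mul, integral_zero, add_zero] using key

/-- **Differences**: for integrable data, the difference of two weak solutions with the same
drift is a weak solution with the differences of sources and data.
[cite: DiPernaLions1989, §II.1 (12)–(14)] -/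
theorem sub (h₁ : IsWeakScalarTransportDiagForcedOn T a κ u s₁ θ₀₁ θ₁)
    (h₂ : IsWeakScalarTransportDiagForcedOn T a κ u s₂ θ₀₂ θ₂) (hθ₀₁ : Integrable θ₀₁ volume)
    (hθ₀₂ : Integrable θ₀₂ volume) :
    IsWeakScalarTransportDiagForcedOn T a κ u (fun t x => s₁ t x - s₂ t x) (fun x => θ₀₁ x - θ₀₂ x)
      (fun t x => θ₁ t x - θ₂ t x) := by
  refine ⟨h₁.aestronglyMeasurable.sub h₂.aestronglyMeasurable, h₁.aestronglyMeasurable_velocity,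
    h₁.aestronglyMeasurable_source.sub h₂.aestronglyMeasurable_source, ae_lintegral_sq_sub_le_aux h₁ h₂,
    h₁.lintegral_velocity_lt_top, lintegral_mul_sub_lt_top_aux h₁ h₂, lintegral_source_sub_lt_top_aux h₁ h₂,
    h₁.ae_isWeaklyDivFree, fun ψ hψ => ?_⟩
  have key := weak_sub_aux h₁ h₂ hψ
  obtain ⟨C₀, hC₀⟩ := FunctionSpaces.Torus.exists_forall_norm_le_of_continuous (hψ.isSmooth_slice 0).continuous
  have i1 : Integrable (fun x => θ₀₁ x * ψ 0 x) volume :=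
    hθ₀₁.mul_bdd (hψ.isSmooth_slice 0).continuous.aestronglyMeasurable (Eventually.of_forall hC₀)
  have i2 : Integrable (fun x => θ₀₂ x * ψ 0 x) volume :=
    hθ₀₂.mul_bdd (hψ.isSmooth_slice 0).continuous.aestronglyMeasurable (Eventually.of_forall hC₀)
  have e : (∫ x, (θ₀₁ x - θ₀₂ x) * ψ 0 x) = (∫ x, θ₀₁ x * ψ 0 x) - ∫ x, θ₀₂ x * ψ 0 x := by
    rw [← integral_sub i1 i2]
    exact integral_congr_ae (Eventually.of_forall fun x => by ring)
  rw [e]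
  exact key

/-- **Sums**: for integrable data, the sum of two weak solutions with the same drift is a weak
solution with the sums of sources and data. [cite: DiPernaLions1989, §II.1 (12)–(14)] -/
theorem add (h₁ : IsWeakScalarTransportDiagForcedOn T a κ u s₁ θ₀₁ θ₁)
    (h₂ : IsWeakScalarTransportDiagForcedOn T a κ u s₂ θ₀₂ θ₂) (hθ₀₁ : Integrable θ₀₁ volume)
    (hθ₀₂ : Integrable θ₀₂ volume) :
    IsWeakScalarTransportDiagForcedOn T a κ u (fun t x => s₁ t x + s₂ t x) (fun x => θ₀₁ x + θ₀₂ x)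
      (fun t x => θ₁ t x + θ₂ t x) := by
  have h₂' := h₂.smul (-1)
  have key := h₁.sub h₂' hθ₀₁ (hθ₀₂.const_mul (-1))
  have e1 : (fun t x => s₁ t x - -1 * s₂ t x) = fun t x => s₁ t x + s₂ t x := by
    funext t x; ring
  have e2 : (fun x => θ₀₁ x - -1 * θ₀₂ x) = fun x => θ₀₁ x + θ₀₂ x := by
    funext x; ring
  have e3 : (fun t x => θ₁ t x - -1 * θ₂ t x) = fun t x => θ₁ t x + θ₂ t x := by
    funext t x; ring
  rw [e1, e2, e3] at key
  exact key

/-- **Duhamel splitting, the forced remainder**: if `θ` solves the sourced problem and `θʰ` the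
homogeneous one (`Torus.IsWeakScalarTransportDiagOn`) with the same drift and datum, then
`θ - θʰ` solves the sourced problem from datum `0`. [cite: DiPernaLions1989, §II.1 (12)–(14)] -/
theorem sub_homogeneous (h : IsWeakScalarTransportDiagForcedOn T a κ u s θ₀ θ) {θh : ℝ → UnitAddTorus d → ℝ}
    (hh : IsWeakScalarTransportDiagOn T a κ u θ₀ θh) :
    IsWeakScalarTransportDiagForcedOn T a κ u s 0 (fun t x => θ t x - θh t x) := by
  have key := sub_of_eq_datum h (isWeakScalarTransportDiagForcedOn_zero_iff.2 hh)
  have e : (fun t x => s t x - (0 : ℝ → UnitAddTorus d → ℝ) t x) = s := by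
    funext t x; simp
  rw [e] at key
  exact key

end IsWeakScalarTransportDiagForcedOn

end Torus

end Literature.Analysis.FluidPDE

end
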